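import Literature.NumberTheory.EllipticCurves.IwasawaAlgebraEisensteinQuotientTorsionProofs
import Literature.GroupTheory.FiniteAbelian.CharacterModuleUnitAddCircle
import Mathlib.Algebra.Module.CharacterModule
import HarnessLib

/-!
# The Pontryagin dual of `𝒟 ⊕ M ⊕ M` (`𝒟` divisible, `M` finite): its `R`-torsion is `M^∨ ⊕ M^∨`, and over
# `S_m = Λ/(T^m + p)` the dual `M^∨` has the same length as `M`

`Proofs`-style file (THEOREMS ONLY: no definition, no named fact, no instance, no `sorry`), topic
`NumberTheory/EllipticCurves` (next to `IwasawaAlgebraEisensteinQuotientDVRProofs` /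
`IwasawaAlgebraEisensteinQuotientTorsionProofs`, whose cardinality–length dictionary over the discrete valuation
ring `S_m = ℤ_p⟦T⟧/(T^m + p)` it extends to Pontryagin duals).

## Why (cell `pub/bsd-print-x9`, rows 9/10, the shared μ-item; seat `bsd-line-x9-p1` LEAD g3, 2026-08-28)

Howard's abstract Kolyvagin bound over a discrete valuation ring `R` (B. Howard, *The Heegner point Kolyvagin
system*, Compositio Math. 140 (2004), Thm. 1.6.1) delivers its conclusion in the DISCRETE currency
`H¹_𝓕(K, A) ≅ 𝒟 ⊕ M ⊕ M`, `𝒟 = Φ/R`, `M` finite, `len_R M ≤ len_R(H¹_𝓕(K,T)/R·κ₁)`; the tree's witness interface for the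
specialised Kolyvagin inequality at the Eisenstein primes `q_m = T^m + p`
(`Summit.….HeegnerMuPartStabilized.nonempty_specWitness_of_dvrData_prod`, cell file
`Theorems/PrintX9MuPartSpecWitnessOfDVRData.lean`) asks instead for the COMPACT currency: an `S_m`-module `Xq`
receiving `𝒳/q_m𝒳` whose torsion submodule is `≅ M' ⊕ M'` with `len M' ≤ len(H/S_m·κ₁)`.  The passage is Pontryagin
duality: `Xq := H¹_𝓕(K,A)^∨ = Hom_ℤ(H¹_𝓕(K,A), ℚ/ℤ)` (Mathlib `CharacterModule`, an `R`-module through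
`(r • χ)(a) = χ(r • a)`), and `(𝒟 ⊕ M ⊕ M)^∨ = 𝒟^∨ ⊕ M^∨ ⊕ M^∨` with `𝒟^∨` torsion-free (a divisible module has a
torsion-free dual) and `M^∨` torsion of the same cardinality — hence, over `S_m`, of the same LENGTH — as `M`.
This file proves exactly that piece of module algebra; nothing arithmetic is asserted. BSD is not proved by any
of this.

## What is proved (namespace `Literature.NumberTheory.EllipticCurves`)

* §1 `CharacterDual.nonempty_linearEquiv_prod` — `(A × B)^∨ ≃ₗ[R] A^∨ × B^∨`.
* §2 `CharacterDual.torsion_eq_bot_of_divisible` — `𝒟` divisible by every non-zero-divisor ⇒ `torsion_R(𝒟^∨) = ⊥`;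
  `CharacterDual.torsion_eq_top_of_smul_eq_zero` — `a • M = 0` for some `a ∈ R⁰` ⇒ `torsion_R(M^∨) = ⊤`
  (private: such an `a` exists for a finite module over a domain of characteristic zero, `a = #M`).
* §3 (private plumbing) `torsion_R(A × B) = torsion_R(A) × torsion_R(B)`; torsion is transported by linear
  equivalences.
* §4 `CharacterDual.nonempty_torsion_linearEquiv_of_linearEquiv_prod` — **`𝒜 ≃ₗ[R] 𝒟 × (M × M)`, `𝒟` divisible,
  `a • M = 0` (`a ∈ R⁰`) ⇒ `torsion_R(𝒜^∨) ≃ₗ[R] M^∨ × M^∨`.**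
* §5 over `S_m` (`1 ≤ m`): `IwasawaAlgebra.length_characterModule_eq` — `len_{S_m}(M^∨) = len_{S_m}(M)` for finite
  `M`; `IwasawaAlgebra.nonempty_torsion_characterModule_linearEquiv_of_howardShape` — the assembled statement in the
  shape consumed by `nonempty_specWitness_of_dvrData_prod` (an `S_m`-isomorphism `torsion(𝒜^∨) ≃ M^∨ × M^∨`, `M^∨`
  finite, `len M^∨ = len M`).

References: [Howard2004HeegnerKolyvagin] B. Howard, Compositio Math. 140 (2004) 1439–1472, Thm. 1.6.1 and its proof
("The compact Selmer group `H¹_𝓕(K,T)` is the `π`-adic Tate module of `H¹_𝓕(K,A)`"); [Brown1982] K. S. Brown,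
*Cohomology of Groups*, III §4 (`ℚ/ℤ` injective; duals of divisible groups); [Washington1997] §13.2 (length/cardinality
over `Λ/𝔮`); [MastellaZerman2026] Thm. 2.40 (the same shape `Φ/𝓡 ⊕ M ⊕ M`).
-/

noncomputable section

open scoped nonZeroDivisors

universe u v w

namespace Literature.NumberTheory.EllipticCurves

/-! ## §1 The dual of a product -/

namespace CharacterDual

variable {R : Type u} [CommRing R]

/-- **`(A × B)^∨ ≅ A^∨ × B^∨`**, `R`-linearly: `χ ↦ (χ ∘ inl, χ ∘ inr)` with inverse
`(χ₁, χ₂) ↦ χ₁ ∘ fst + χ₂ ∘ snd`. [cite: Brown1982, III §4] -/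
theorem nonempty_linearEquiv_prod (A : Type v) (B : Type w) [AddCommGroup A] [AddCommGroup B] [Module R A]
    [Module R B] :
    Nonempty (CharacterModule (A × B) ≃ₗ[R] CharacterModule A × CharacterModule B) := by
  refine ⟨{ toFun := fun χ => (CharacterModule.dual (LinearMap.inl R A B) χ,
              CharacterModule.dual (LinearMap.inr R A B) χ)
            map_add' := fun χ χ' => by simp only [map_add, Prod.mk_add_mk]
            map_smul' := fun r χ => by simp only [map_smul, Prod.smul_mk, RingHom.id_apply]
            invFun := fun χ => CharacterModule.dual (LinearMap.fst R A B) χ.1 +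
              CharacterModule.dual (LinearMap.snd R A B) χ.2
            left_inv := fun χ => ?_
            right_inv := fun χ => ?_ }⟩
  · ext x
    change χ (LinearMap.inl R A B (LinearMap.fst R A B x)) + χ (LinearMap.inr R A B (LinearMap.snd R A B x)) = χ x
    rw [← map_add]
    congr 1
    ext <;> simp
  · ext a
    · change χ.1 (LinearMap.fst R A B (LinearMap.inl R A B a)) + χ.2 (LinearMap.snd R A B (LinearMap.inl R A B a))
        = χ.1 a
      simp
    · change χ.1 (LinearMap.fst R A B (LinearMap.inr R A B a)) + χ.2 (LinearMap.snd R A B (LinearMap.inr R A B a))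
        = χ.2 a
      simp

/-! ## §2 Duals of divisible and of bounded-torsion modules -/

/-- **A divisible module has a torsion-free dual**: if every non-zero-divisor `r` acts surjectively on `𝒟`, then
`torsion_R(𝒟^∨) = ⊥` (`(r • χ)(d') = χ(r • d')` exhausts all values of `χ`). [cite: Brown1982, III §4] -/
theorem torsion_eq_bot_of_divisible (D : Type v) [AddCommGroup D] [Module R D]
    (hD : ∀ r : R⁰, ∀ d : D, ∃ d' : D, (r : R) • d' = d) :
    Submodule.torsion R (CharacterModule D) = ⊥ := by
  rw [eq_bot_iff]
  intro χ hχ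
  obtain ⟨r, hr⟩ := (Submodule.mem_torsion_iff χ).mp hχ
  rw [Submodule.mem_bot]
  ext d
  obtain ⟨d', rfl⟩ := hD r d
  have h := DFunLike.congr_fun hr d'
  rw [Submonoid.smul_def, CharacterModule.smul_apply] at h
  rw [h]
  rfl

/-- **A module killed by a non-zero-divisor has an all-torsion dual**: `a • M = 0` with `a ∈ R⁰` ⇒
`torsion_R(M^∨) = ⊤`. [cite: Brown1982, III §4] -/
theorem torsion_eq_top_of_smul_eq_zero (M : Type v) [AddCommGroup M] [Module R M] (a : R⁰)
    (ha : ∀ m : M, (a : R) • m = 0) :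
    Submodule.torsion R (CharacterModule M) = ⊤ := by
  rw [eq_top_iff]
  intro χ _
  refine (Submodule.mem_torsion_iff χ).mpr ⟨a, ?_⟩
  ext m
  rw [Submonoid.smul_def, CharacterModule.smul_apply, ha m, map_zero]
  rfl

/-- **A finite module over a domain of characteristic zero is killed by the non-zero-divisor `#M`.** [folklore] -/
private theorem exists_nonZeroDivisor_smul_eq_zero_of_finite [IsDomain R] [CharZero R] (M : Type v) [AddCommGroup M]
    [Module R M] [Finite M] :
    ∃ a : R⁰, ∀ m : M, (a : R) • m = 0 := by
  haveI : Nonempty M := ⟨0⟩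
  refine ⟨⟨(Nat.card M : R), mem_nonZeroDivisors_of_ne_zero ?_⟩, fun m => ?_⟩
  · exact_mod_cast (Nat.card_pos (α := M)).ne'
  · change ((Nat.card M : ℕ) : R) • m = 0
    rw [Nat.cast_smul_eq_nsmul]
    exact card_nsmul_eq_zero'

/-! ## §3 Torsion of a product; transport along equivalences (private plumbing) -/

/-- `torsion_R(A × B) = torsion_R(A) × torsion_R(B)` (if `r a = 0` and `s b = 0` with `r, s ∈ R⁰` then
`rs` kills `(a, b)`). [folklore] -/
private theorem torsion_prod_eq (A : Type v) (B : Type w) [AddCommGroup A] [AddCommGroup B] [Module R A] [Module R B] :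
    Submodule.torsion R (A × B) = (Submodule.torsion R A).prod (Submodule.torsion R B) := by
  ext x
  simp only [Submodule.mem_prod, Submodule.mem_torsion_iff]
  constructor
  · rintro ⟨r, hr⟩
    rw [Submonoid.smul_def, Prod.smul_mk, Prod.mk_eq_zero] at hr
    exact ⟨⟨r, by rw [Submonoid.smul_def]; exact hr.1⟩, ⟨r, by rw [Submonoid.smul_def]; exact hr.2⟩⟩
  · rintro ⟨⟨r, hr⟩, ⟨s, hs⟩⟩
    refine ⟨r * s, ?_⟩
    rw [Submonoid.smul_def, Submonoid.coe_mul, Prod.smul_mk, Prod.mk_eq_zero]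
    rw [Submonoid.smul_def] at hr hs
    constructor
    · rw [mul_comm, mul_smul, hr, smul_zero]
    · rw [mul_smul, hs, smul_zero]

/-- Torsion is transported by linear equivalences: `e(torsion_R A) = torsion_R B`. [folklore] -/
private theorem map_torsion_linearEquiv {A : Type v} {B : Type w} [AddCommGroup A] [AddCommGroup B] [Module R A]
    [Module R B] (e : A ≃ₗ[R] B) :
    (Submodule.torsion R A).map (e : A →ₗ[R] B) = Submodule.torsion R B := by
  ext y
  simp only [Submodule.mem_map, Submodule.mem_torsion_iff, LinearEquiv.coe_coe]
  constructor
  · rintro ⟨x, ⟨r, hr⟩, rfl⟩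
    refine ⟨r, ?_⟩
    rw [Submonoid.smul_def] at hr ⊢
    rw [← map_smul, hr, map_zero]
  · rintro ⟨r, hr⟩
    refine ⟨e.symm y, ⟨r, ?_⟩, e.apply_symm_apply y⟩
    rw [Submonoid.smul_def] at hr ⊢
    rw [← map_smul, hr, map_zero]

/-! ## §4 The torsion of `(𝒟 ⊕ M ⊕ M)^∨` -/

/-- **`𝒜 ≅ 𝒟 ⊕ M ⊕ M` with `𝒟` divisible and `M` of bounded torsion ⇒ `torsion_R(𝒜^∨) ≅ M^∨ ⊕ M^∨`** — the torsion
of the Pontryagin dual of Howard's `H¹_𝓕(K, A) ≅ 𝒟 ⊕ M ⊕ M`. [cite: Howard2004HeegnerKolyvagin, Thm. 1.6.1]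
[cite: Brown1982, III §4] -/
theorem nonempty_torsion_linearEquiv_of_linearEquiv_prod {𝒜 : Type v} {D M : Type v} [AddCommGroup 𝒜]
    [AddCommGroup D] [AddCommGroup M] [Module R 𝒜] [Module R D] [Module R M] (e : 𝒜 ≃ₗ[R] D × (M × M))
    (hD : ∀ r : R⁰, ∀ d : D, ∃ d' : D, (r : R) • d' = d) (a : R⁰) (ha : ∀ m : M, (a : R) • m = 0) :
    Nonempty (Submodule.torsion R (CharacterModule 𝒜) ≃ₗ[R] CharacterModule M × CharacterModule M) := by
  classical
  obtain ⟨e₁⟩ := nonempty_linearEquiv_prod (R := R) D (M × M)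
  obtain ⟨e₂⟩ := nonempty_linearEquiv_prod (R := R) M M
  -- `𝒜^∨ ≅ 𝒟^∨ × (M^∨ × M^∨)`
  let E : CharacterModule 𝒜 ≃ₗ[R] CharacterModule D × (CharacterModule M × CharacterModule M) :=
    (CharacterModule.congr e).trans (e₁.trans (LinearEquiv.prodCongr (LinearEquiv.refl R _) e₂))
  -- torsion of the right-hand side
  have htors : Submodule.torsion R (CharacterModule D × (CharacterModule M × CharacterModule M)) =
      (⊥ : Submodule R (CharacterModule D)).prod ⊤ := by
    rw [torsion_prod_eq, torsion_eq_bot_of_divisible D hD, torsion_prod_eq,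
      torsion_eq_top_of_smul_eq_zero M a ha, Submodule.prod_top]
  -- transport
  have hmap : (Submodule.torsion R (CharacterModule 𝒜)).map
      (E : CharacterModule 𝒜 →ₗ[R] CharacterModule D × (CharacterModule M × CharacterModule M)) =
      (⊥ : Submodule R (CharacterModule D)).prod ⊤ := by
    rw [map_torsion_linearEquiv, htors]
  let E' : Submodule.torsion R (CharacterModule 𝒜) ≃ₗ[R]
      ((⊥ : Submodule R (CharacterModule D)).prod (⊤ : Submodule R (CharacterModule M × CharacterModule M))) :=
    E.submoduleMap _ |>.trans (LinearEquiv.ofEq _ _ hmap)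
  -- `⊥ × ⊤ ≅ M^∨ × M^∨`
  let E'' : ((⊥ : Submodule R (CharacterModule D)).prod (⊤ : Submodule R (CharacterModule M × CharacterModule M)))
      ≃ₗ[R] CharacterModule M × CharacterModule M :=
    { toFun := fun x => x.1.2
      map_add' := fun _ _ => rfl
      map_smul' := fun _ _ => rfl
      invFun := fun y => ⟨(0, y), by simp [Submodule.mem_prod]⟩
      left_inv := fun x => by
        obtain ⟨⟨x1, x2⟩, hx⟩ := x
        have hx1 : x1 = 0 := by simpa [Submodule.mem_prod] using hx
        subst hx1
        rfl
      right_inv := fun _ => rfl }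
  exact ⟨E'.trans E''⟩

end CharacterDual

/-! ## §5 Over `S_m = Λ/(T^m + p)`: the dual of a finite module has the same length -/

namespace IwasawaAlgebra

variable (p : ℕ) [hp : Fact p.Prime]

/-- **`len_{S_m}(M^∨) = len_{S_m}(M)` for a finite `S_m`-module `M`**: both are finite of the same cardinality
(`Hom(M, ℚ/ℤ) ≃ M` as groups) and `#N = p^{len N}` for finite `S_m`-modules. [cite: Washington1997, §13.2]
[cite: Howard2004HeegnerKolyvagin, proof of Thm. 2.2.10 (𝔮 = T^m + p)] -/
theorem length_characterModule_eq {m : ℕ} (hm : 1 ≤ m) (M : Type v) [AddCommGroup M]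
    [_root_.Module (IwasawaAlgebra p ⧸
      Ideal.span {(PowerSeries.X ^ m + PowerSeries.C (p : ℤ_[p]) : IwasawaAlgebra p)}) M] [Finite M] :
    Module.length (IwasawaAlgebra p ⧸
        Ideal.span {(PowerSeries.X ^ m + PowerSeries.C (p : ℤ_[p]) : IwasawaAlgebra p)}) (CharacterModule M) =
      Module.length (IwasawaAlgebra p ⧸
        Ideal.span {(PowerSeries.X ^ m + PowerSeries.C (p : ℤ_[p]) : IwasawaAlgebra p)}) M := by
  obtain ⟨eM⟩ := Literature.GroupTheory.FiniteAbelian.nonempty_characterModule_addEquiv (A := M)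
  haveI : Finite (CharacterModule M) := Finite.of_equiv M eM.symm.toEquiv
  have hcard : Nat.card (CharacterModule M) = Nat.card M := Nat.card_congr eM.toEquiv
  rw [natCard_eq_pow_length_quotient_X_pow_add_C_of_finite p hm,
    natCard_eq_pow_length_quotient_X_pow_add_C_of_finite p hm (N := M)] at hcard
  have h := Nat.pow_right_injective hp.out.two_le hcard
  have h1 : Module.length (IwasawaAlgebra p ⧸
      Ideal.span {(PowerSeries.X ^ m + PowerSeries.C (p : ℤ_[p]) : IwasawaAlgebra p)}) (CharacterModule M) ≠ ⊤ :=
    Module.length_ne_top_iff.mpr Module.isFiniteLength_of_finite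
  have h2 : Module.length (IwasawaAlgebra p ⧸
      Ideal.span {(PowerSeries.X ^ m + PowerSeries.C (p : ℤ_[p]) : IwasawaAlgebra p)}) M ≠ ⊤ :=
    Module.length_ne_top_iff.mpr Module.isFiniteLength_of_finite
  obtain ⟨a, ha⟩ := ENat.ne_top_iff_exists.mp h1
  obtain ⟨b, hb⟩ := ENat.ne_top_iff_exists.mp h2
  rw [← ha, ← hb] at h ⊢
  simp only [ENat.toNat_coe] at h
  rw [h]

/-- **The Howard shape, dualised over `S_m`.** For `S_m`-modules `𝒜 ≅ 𝒟 × (M × M)` with `𝒟` divisible by the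
non-zero-divisors of `S_m` and `M` finite: the `S_m`-torsion of `𝒜^∨ = Hom(𝒜, ℚ/ℤ)` is `≅ M^∨ × M^∨`, `M^∨` is finite, and
`len M^∨ = len M` — so a bound `len M ≤ len(H/S_m·κ₁)` (Howard Thm. 1.6.1 / Mastella–Zerman Thm. 2.40) is the same bound
for `M^∨`, the input `eM`/`hM` of the tree's `nonempty_specWitness_of_dvrData_prod`.
[cite: Howard2004HeegnerKolyvagin, Thm. 1.6.1] [cite: MastellaZerman2026, Thm. 2.40] -/
theorem nonempty_torsion_characterModule_linearEquiv_of_howardShape {m : ℕ} (hm : 1 ≤ m)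
    {𝒜 D M : Type v} [AddCommGroup 𝒜] [AddCommGroup D] [AddCommGroup M]
    [_root_.Module (IwasawaAlgebra p ⧸
      Ideal.span {(PowerSeries.X ^ m + PowerSeries.C (p : ℤ_[p]) : IwasawaAlgebra p)}) 𝒜]
    [_root_.Module (IwasawaAlgebra p ⧸
      Ideal.span {(PowerSeries.X ^ m + PowerSeries.C (p : ℤ_[p]) : IwasawaAlgebra p)}) D]
    [_root_.Module (IwasawaAlgebra p ⧸
      Ideal.span {(PowerSeries.X ^ m + PowerSeries.C (p : ℤ_[p]) : IwasawaAlgebra p)}) M] [Finite M]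
    (e : 𝒜 ≃ₗ[IwasawaAlgebra p ⧸
      Ideal.span {(PowerSeries.X ^ m + PowerSeries.C (p : ℤ_[p]) : IwasawaAlgebra p)}] D × (M × M))
    (hD : ∀ r : (IwasawaAlgebra p ⧸
        Ideal.span {(PowerSeries.X ^ m + PowerSeries.C (p : ℤ_[p]) : IwasawaAlgebra p)})⁰,
      ∀ d : D, ∃ d' : D, (r : IwasawaAlgebra p ⧸
        Ideal.span {(PowerSeries.X ^ m + PowerSeries.C (p : ℤ_[p]) : IwasawaAlgebra p)}) • d' = d) :
    Nonempty (Submodule.torsion (IwasawaAlgebra p ⧸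
        Ideal.span {(PowerSeries.X ^ m + PowerSeries.C (p : ℤ_[p]) : IwasawaAlgebra p)}) (CharacterModule 𝒜)
      ≃ₗ[IwasawaAlgebra p ⧸ Ideal.span {(PowerSeries.X ^ m + PowerSeries.C (p : ℤ_[p]) : IwasawaAlgebra p)}]
      CharacterModule M × CharacterModule M) ∧
    Finite (CharacterModule M) ∧
    Module.length (IwasawaAlgebra p ⧸
        Ideal.span {(PowerSeries.X ^ m + PowerSeries.C (p : ℤ_[p]) : IwasawaAlgebra p)}) (CharacterModule M) =
      Module.length (IwasawaAlgebra p ⧸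
        Ideal.span {(PowerSeries.X ^ m + PowerSeries.C (p : ℤ_[p]) : IwasawaAlgebra p)}) M := by
  haveI := isDomain_quotient_X_pow_add_C p hm
  haveI : CharZero (IwasawaAlgebra p ⧸
      Ideal.span {(PowerSeries.X ^ m + PowerSeries.C (p : ℤ_[p]) : IwasawaAlgebra p)}) :=
    charZero_of_inj_zero fun n hn => by
      by_contra hne
      exact natCast_ne_zero p hm hne hn
  obtain ⟨a, ha⟩ := CharacterDual.exists_nonZeroDivisor_smul_eq_zero_of_finite
    (R := IwasawaAlgebra p ⧸ Ideal.span {(PowerSeries.X ^ m + PowerSeries.C (p : ℤ_[p]) : IwasawaAlgebra p)}) M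
  obtain ⟨eM⟩ := Literature.GroupTheory.FiniteAbelian.nonempty_characterModule_addEquiv (A := M)
  exact ⟨CharacterDual.nonempty_torsion_linearEquiv_of_linearEquiv_prod e hD a ha,
    Finite.of_equiv M eM.symm.toEquiv, length_characterModule_eq p hm M⟩

end IwasawaAlgebra

end Literature.NumberTheory.EllipticCurves

end
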